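import Literature.Analysis.FluidPDE.NSFourierBilinear
import Mathlib.Analysis.SpecificLimits.Basic
import Mathlib.MeasureTheory.Integral.DominatedConvergence
import Mathlib.Topology.UniformSpace.UniformApproximation
import HarnessLib

/-!
# Picard iteration for the Fourier-transformed Navier–Stokes system

Third file of the Fourier-side construction of Leray's local regular solution
(`Literature.Fluid.local_regular_solution`; plan in `NSLocalRegular`). For a viscosity rate
`c = 4π²ν > 0`, Fourier data `a : E → ℂ^ι` (`E = EuclideanSpace ℝ ι`) and the projected
nonlinearity `N` of `NSFourierBilinear`, the mild (Duhamel) form of the transformed system is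
the fixed-point equation

  `v(t, ξ) = e^{-c‖ξ‖²t} a(ξ) − ∫₀ᵗ e^{-c‖ξ‖²(t-s)} N(v(s), v(s))(ξ) ds`,  `0 ≤ t ≤ T`

(Leray 1934, §19 solves the physical-space form by successive approximations; the Fourier /
pseudo-measure form is Le Jan–Sznitman's, cf. Cannone 2004, §2.4, Lemarié-Rieusset 2016, §8.5;
modern statement of Leray's theorem: Ożański–Pooley 2018, Thm. 6.22). We run the Picard
iteration `v₀ = e^{-c‖ξ‖²t} a`, `v_{n+1} = Φ(v_n)` **pointwise**, with all estimates as explicit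
constants (no Banach-space packaging): on the explicit time interval
`T = picardTime c K₀ R = c / (4e C₀ R + 1)²` (`C₀ = nonlinConst ι K₀ K₀`, `R = 2A`, `A` the
order-`K₀` decay constant of `a`, `K₀ > card ι`)

* every iterate is jointly continuous, obeys `‖v_n(t, ξ)‖ ≤ R (1 + ‖ξ‖)^{-K₀}` and
  `‖v_{n+1} − v_n‖ ≤ 2R 2^{-n} (1 + ‖ξ‖)^{-K₀}` (contraction factor `1/2`);
* the pointwise limit `v = picardLimit` is jointly continuous, solves the fixed-point equation
  exactly, has `v(0) = a`, inherits **every** polynomial decay of `a` on the same interval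
  (`‖v(t,ξ)‖ ≤ 2A_K e^{λ_K T}(1+‖ξ‖)^{-K}`, the time-weight `e^{λ_K t}` trick with
  `λ_K = (4 C_K² R² + 1)/c`), is divergence free on the Fourier side (`∑ₗ ξₗ vₗ = 0`) when `a`
  is, and has the conjugation symmetry `v(t,-ξ) = conj v(t,ξ)` (reality of `𝓕 v(t)`) when `a`
  has.

Time is **clamped** to `[0, T]` (`clamp T t = max 0 (min t T)`) inside `Φ`, so that all maps are
defined and continuous on `ℝ × E` and constant in `t` outside `[0, T]`; on `[0, T]` this is the
genuine Duhamel formula.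

## Mathlib search

`intervalIntegral.continuous_parametric_intervalIntegral_of_continuous`,
`intervalIntegral.norm_integral_le_of_norm_le`, `ContinuousLinearMap.intervalIntegral_comp_comm`,
`intervalIntegral_conj`, `cauchySeq_of_le_geometric`, `dist_le_of_le_geometric_of_tendsto`,
`TendstoUniformly.continuous`. Mathlib has no heat semigroup / mild Navier–Stokes iteration.

## References

* J. Leray, Acta Math. 63 (1934), §19 (successive approximations for the regular solution). [Leray1934]
* W. S. Ożański, B. C. Pooley, LMS LN 452, CUP 2018, Thm. 6.22. [OzanskiPooley2018]
* P. G. Lemarié-Rieusset, *The Navier–Stokes problem in the 21st century*, CRC 2016, §8.5.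
* M. Cannone, Handbook of Mathematical Fluid Dynamics III (2004), §2.4.
-/

noncomputable section

open MeasureTheory Real Set Filter Topology Function
open scoped Convolution ComplexConjugate

namespace Literature.Analysis.FluidPDE.FourierNS

/-! ### Clamped time and the heat factor -/

section Clamp

/-- Time clamped to `[0, T]`: `clamp T t = max 0 (min t T)`. [folklore] -/
def clamp (T t : ℝ) : ℝ := max 0 (min t T)

variable {T t : ℝ}

/-- `0 ≤ clamp T t`. [folklore] -/
theorem clamp_nonneg (T t : ℝ) : 0 ≤ clamp T t := le_max_left _ _

/-- `clamp T t ≤ T` for `T ≥ 0`. [folklore] -/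
theorem clamp_le (hT : 0 ≤ T) (t : ℝ) : clamp T t ≤ T := max_le hT (min_le_right _ _)

/-- `clamp T t ∈ [0, T]`. [folklore] -/
theorem clamp_mem_Icc (hT : 0 ≤ T) (t : ℝ) : clamp T t ∈ Icc 0 T := ⟨clamp_nonneg T t, clamp_le hT t⟩

/-- On `[0, T]` the clamp is the identity. [folklore] -/
theorem clamp_of_mem (ht : t ∈ Icc 0 T) : clamp T t = t := by
  simp [clamp, min_eq_left ht.2, max_eq_right ht.1]

/-- `clamp T 0 = 0`. [folklore] -/
@[simp]
theorem clamp_zero (hT : 0 ≤ T) : clamp T 0 = 0 := clamp_of_mem ⟨le_rfl, hT⟩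

/-- Clamping is idempotent. [folklore] -/
theorem clamp_clamp (hT : 0 ≤ T) (t : ℝ) : clamp T (clamp T t) = clamp T t :=
  clamp_of_mem (clamp_mem_Icc hT t)

/-- The clamp is continuous. [folklore] -/
theorem continuous_clamp (T : ℝ) : Continuous (clamp T) :=
  continuous_const.max (continuous_id.min continuous_const)

end Clamp

section Heat

variable {E : Type*} [NormedAddCommGroup E]

/-- The heat factor `e^{-c‖ξ‖² t}`, the Fourier multiplier of `e^{νtΔ}` for `c = 4π²ν`. [folklore] -/
def heat (c : ℝ) (ξ : E) (t : ℝ) : ℝ := Real.exp (-(c * ‖ξ‖ ^ 2) * t)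

variable {c t : ℝ} {ξ : E}

/-- The heat factor is positive. [folklore] -/
theorem heat_pos (c : ℝ) (ξ : E) (t : ℝ) : 0 < heat c ξ t := Real.exp_pos _

/-- The heat factor is nonnegative. [folklore] -/
theorem heat_nonneg (c : ℝ) (ξ : E) (t : ℝ) : 0 ≤ heat c ξ t := (heat_pos c ξ t).le

/-- `heat c ξ 0 = 1`. [folklore] -/
@[simp]
theorem heat_zero (c : ℝ) (ξ : E) : heat c ξ 0 = 1 := by simp [heat]

/-- The heat factor is at most `1` for `c, t ≥ 0`. [folklore] -/
theorem heat_le_one (hc : 0 ≤ c) (ht : 0 ≤ t) (ξ : E) : heat c ξ t ≤ 1 := by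
  rw [heat, Real.exp_le_one_iff]
  have : 0 ≤ c * ‖ξ‖ ^ 2 * t := by positivity
  linarith

/-- The heat factor is even in the frequency. [folklore] -/
@[simp]
theorem heat_neg (c : ℝ) (ξ : E) (t : ℝ) : heat c (-ξ) t = heat c ξ t := by simp [heat]

/-- Joint continuity of the heat factor in `(ξ, t)`. [folklore] -/
theorem continuous_heat (c : ℝ) : Continuous fun p : E × ℝ => heat c p.1 p.2 := by
  unfold heat; fun_prop

/-- Continuity of `x ↦ heat c (f x) (g x)` for continuous `f`, `g`. [folklore] -/
theorem continuous_heat_comp {X : Type*} [TopologicalSpace X] {f : X → E} {g : X → ℝ} (c : ℝ)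
    (hf : Continuous f) (hg : Continuous g) : Continuous fun x => heat c (f x) (g x) := by
  simp only [heat]; fun_prop

/-- `‖heat • x‖ = heat * ‖x‖`. [folklore] -/
theorem norm_heat_smul {F : Type*} [NormedAddCommGroup F] [NormedSpace ℝ F] (c : ℝ) (ξ : E)
    (t : ℝ) (x : F) : ‖heat c ξ t • x‖ = heat c ξ t * ‖x‖ := by
  rw [norm_smul, Real.norm_of_nonneg (heat_nonneg c ξ t)]

end Heat

/-! ### The Duhamel map -/

section Duhamel

variable {ι : Type*} [Fintype ι] [DecidableEq ι]

/-- The (clamped) Duhamel map of the transformed Navier–Stokes system: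
`Φ(v)(t, ξ) = e^{-c‖ξ‖²τ} a(ξ) − ∫₀^τ e^{-c‖ξ‖²(τ-s)} N(v(s), v(s))(ξ) ds`, `τ = clamp T t`
(Leray 1934, §19, (3.11)-type successive approximations in Fourier form; Lemarié-Rieusset 2016,
§8.5). [folklore] -/
def duhamel (c T : ℝ) (a : EuclideanSpace ℝ ι → ι → ℂ) (v : ℝ → EuclideanSpace ℝ ι → ι → ℂ)
    (t : ℝ) (ξ : EuclideanSpace ℝ ι) : ι → ℂ :=
  heat c ξ (clamp T t) • a ξ -
    ∫ s in (0 : ℝ)..clamp T t, heat c ξ (clamp T t - s) • nonlin (v s) (v s) ξ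

variable {c T : ℝ} {K₀ K : ℕ} {R A D M : ℝ} {a : EuclideanSpace ℝ ι → ι → ℂ}
  {v w : ℝ → EuclideanSpace ℝ ι → ι → ℂ}

/-- The Duhamel integral (the nonlinear part of `Φ`). [folklore] -/
def duhamelIntegral (c T : ℝ) (v : ℝ → EuclideanSpace ℝ ι → ι → ℂ) (t : ℝ)
    (ξ : EuclideanSpace ℝ ι) : ι → ℂ :=
  ∫ s in (0 : ℝ)..clamp T t, heat c ξ (clamp T t - s) • nonlin (v s) (v s) ξ

/-- `Φ(v) = heat • a − duhamelIntegral`. [folklore] -/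
theorem duhamel_eq (c T : ℝ) (a : EuclideanSpace ℝ ι → ι → ℂ) (v : ℝ → EuclideanSpace ℝ ι → ι → ℂ)
    (t : ℝ) (ξ : EuclideanSpace ℝ ι) :
    duhamel c T a v t ξ = heat c ξ (clamp T t) • a ξ - duhamelIntegral c T v t ξ := rfl

/-- `Φ(v)(t) = Φ(v)(clamp T t)`: the map only sees clamped time. [folklore] -/
theorem duhamel_clamp (hT : 0 ≤ T) (t : ℝ) (ξ : EuclideanSpace ℝ ι) :
    duhamel c T a v (clamp T t) ξ = duhamel c T a v t ξ := by
  simp only [duhamel, clamp_clamp hT]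

/-- `Φ(v)(0) = a`. [folklore] -/
theorem duhamel_zero (hT : 0 ≤ T) (ξ : EuclideanSpace ℝ ι) : duhamel c T a v 0 ξ = a ξ := by
  simp [duhamel, clamp_zero hT]

/-- The Duhamel integrand is jointly continuous in `((t, ξ), s)` when `v` is jointly continuous
with uniform decay of the integrable order. [folklore] -/
theorem continuous_duhamel_integrand (hK₀ : Fintype.card ι < K₀) (hvc : Continuous (uncurry v))
    (hv : ∀ s, HasDecay K₀ R (v s)) :
    Continuous fun p : (ℝ × EuclideanSpace ℝ ι) × ℝ =>
      heat c p.1.2 (clamp T p.1.1 - p.2) • nonlin (v p.2) (v p.2) p.1.2 := by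
  have hslice : ∀ s, Continuous (v s) := fun s => hvc.uncurry_left s
  have hf : Continuous fun p : (ℝ × EuclideanSpace ℝ ι) × ℝ => p.1.2 := by fun_prop
  have hg : Continuous fun p : (ℝ × EuclideanSpace ℝ ι) × ℝ => clamp T p.1.1 - p.2 := by
    have := continuous_clamp T; fun_prop
  have h1 : Continuous fun p : (ℝ × EuclideanSpace ℝ ι) × ℝ => heat c p.1.2 (clamp T p.1.1 - p.2) :=
    continuous_heat_comp c hf hg
  have hVm : ∀ p : (ℝ × EuclideanSpace ℝ ι) × ℝ, AEStronglyMeasurable (v p.2) volume := fun p =>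
    (hslice p.2).aestronglyMeasurable
  have hVc : ∀ η, Continuous fun p : (ℝ × EuclideanSpace ℝ ι) × ℝ => v p.2 η := fun η => by
    have : (fun p : (ℝ × EuclideanSpace ℝ ι) × ℝ => v p.2 η) = uncurry v ∘ fun p => (p.2, η) := rfl
    rw [this]; exact hvc.comp (by fun_prop)
  have hWc : ∀ η, Continuous fun p : (ℝ × EuclideanSpace ℝ ι) × ℝ => v p.2 (p.1.2 - η) := fun η => by
    have : (fun p : (ℝ × EuclideanSpace ℝ ι) × ℝ => v p.2 (p.1.2 - η)) =
        uncurry v ∘ fun p => (p.2, p.1.2 - η) := rfl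
    rw [this]; exact hvc.comp (by fun_prop)
  have h2 : Continuous fun p : (ℝ × EuclideanSpace ℝ ι) × ℝ => nonlin (v p.2) (v p.2) p.1.2 :=
    continuous_nonlin_param (X := (ℝ × EuclideanSpace ℝ ι) × ℝ) hK₀ (V := fun p => v p.2)
      (W := fun p => v p.2) (ζ := fun p => p.1.2) hVm hVm (fun p => hv p.2) (fun p => hv p.2) hVc hWc
      (by fun_prop)
  exact h1.smul h2

/-- **Continuity of the Duhamel map**: `Φ(v)` is jointly continuous on `ℝ × E` if `v` is, `v`
has uniform decay of the integrable order and `a` is continuous (parametric interval integrals,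
Mathlib `continuous_parametric_intervalIntegral_of_continuous`). [folklore] -/
theorem continuous_duhamel (hK₀ : Fintype.card ι < K₀) (ha : Continuous a)
    (hvc : Continuous (uncurry v)) (hv : ∀ s, HasDecay K₀ R (v s)) :
    Continuous (uncurry (duhamel c T a v)) := by
  have h1 : Continuous fun p : ℝ × EuclideanSpace ℝ ι => heat c p.2 (clamp T p.1) • a p.2 :=
    (continuous_heat_comp c continuous_snd ((continuous_clamp T).comp continuous_fst)).smul
      (ha.comp continuous_snd)
  have h2 : Continuous fun p : ℝ × EuclideanSpace ℝ ι =>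
      ∫ s in (0 : ℝ)..clamp T p.1, heat c p.2 (clamp T p.1 - s) • nonlin (v s) (v s) p.2 :=
    intervalIntegral.continuous_parametric_intervalIntegral_of_continuous (a₀ := 0)
      (continuous_duhamel_integrand hK₀ hvc hv) ((continuous_clamp T).comp continuous_fst)
  have : uncurry (duhamel c T a v) = fun p : ℝ × EuclideanSpace ℝ ι =>
      heat c p.2 (clamp T p.1) • a p.2 -
        ∫ s in (0 : ℝ)..clamp T p.1, heat c p.2 (clamp T p.1 - s) • nonlin (v s) (v s) p.2 := by
    funext p; rfl
  rw [this]
  exact h1.sub h2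

/-- At a fixed frequency the nonlinearity of a jointly continuous, uniformly decaying `v` is
continuous in time. [folklore] -/
theorem continuous_nonlin_time (hK₀ : Fintype.card ι < K₀) (hvc : Continuous (uncurry v))
    (hv : ∀ s, HasDecay K₀ R (v s)) (ξ : EuclideanSpace ℝ ι) :
    Continuous fun s : ℝ => nonlin (v s) (v s) ξ := by
  have hslice : ∀ s, Continuous (v s) := fun s => hvc.uncurry_left s
  have hVm : ∀ s : ℝ, AEStronglyMeasurable (v s) volume := fun s => (hslice s).aestronglyMeasurable
  have hVc : ∀ η, Continuous fun s : ℝ => v s η := fun η => by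
    have : (fun s : ℝ => v s η) = uncurry v ∘ fun s => (s, η) := rfl
    rw [this]; exact hvc.comp (by fun_prop)
  exact continuous_nonlin_param (X := ℝ) hK₀ (V := fun s => v s) (W := fun s => v s)
    (ζ := fun _ => ξ) hVm hVm (fun s => hv s) (fun s => hv s) hVc (fun η => hVc (ξ - η))
    continuous_const

/-- The Duhamel integrand at fixed `(t, ξ)` is continuous in `s`, hence interval integrable. [folklore] -/
theorem continuous_duhamel_integrand_time (hK₀ : Fintype.card ι < K₀) (hvc : Continuous (uncurry v))
    (hv : ∀ s, HasDecay K₀ R (v s)) (τ : ℝ) (ξ : EuclideanSpace ℝ ι) :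
    Continuous fun s : ℝ => heat c ξ (τ - s) • nonlin (v s) (v s) ξ :=
  (continuous_heat_comp c continuous_const (continuous_const.sub continuous_id)).smul
    (continuous_nonlin_time hK₀ hvc hv ξ)

/-! #### The base estimate and the contraction -/

/-- **Picard's time.** `T = c / (4e C₀ R + 1)²`, `C₀ = nonlinConst ι K₀ K₀`: on `[0, T]` the
Duhamel map preserves the ball `‖v(t,ξ)‖ ≤ R (1+‖ξ‖)^{-K₀}` (for data of size `R/2`) and
contracts it with factor `1/2` (Leray 1934, §19: `T > C ν³/‖u₀‖_∞⁴`-type explicit lower bounds;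
here in the Fourier weighted norm). [folklore] -/
def picardTime (ι : Type*) [Fintype ι] (c : ℝ) (K₀ : ℕ) (R : ℝ) : ℝ :=
  c / (4 * Real.exp 1 * nonlinConst ι K₀ K₀ * R + 1) ^ 2

omit [DecidableEq ι] in
/-- `T > 0` for `c > 0`. [folklore] -/
theorem picardTime_pos (hc : 0 < c) (K₀ : ℕ) (R : ℝ) (hR : 0 ≤ R) : 0 < picardTime ι c K₀ R := by
  unfold picardTime
  have := nonlinConst_nonneg (ι := ι) K₀ K₀
  positivity

omit [DecidableEq ι] in
/-- The key numerical fact behind the choice of `T`: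
`e C₀ R √T / √c = e C₀ R / (4 e C₀ R + 1) ≤ 1/4`. [folklore] -/
theorem picard_theta_le (hc : 0 < c) (hR : 0 ≤ R) :
    Real.exp 1 * nonlinConst ι K₀ K₀ * R * Real.sqrt (picardTime ι c K₀ R) / Real.sqrt c ≤ 1 / 4 := by
  have hC := nonlinConst_nonneg (ι := ι) K₀ K₀
  set x := Real.exp 1 * nonlinConst ι K₀ K₀ * R with hx
  have hx0 : 0 ≤ x := by positivity
  have hden : 0 < 4 * x + 1 := by positivity
  have hsq : Real.sqrt (picardTime ι c K₀ R) = Real.sqrt c / (4 * x + 1) := by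
    have hx' : 4 * Real.exp 1 * nonlinConst ι K₀ K₀ * R + 1 = 4 * x + 1 := by
      simp only [hx]; ring
    unfold picardTime
    rw [hx', Real.sqrt_div hc.le, Real.sqrt_sq hden.le]
  rw [hsq]
  have hsc : 0 < Real.sqrt c := Real.sqrt_pos.2 hc
  rw [mul_div_assoc, div_div, mul_comm (4 * x + 1), ← div_div, div_self hsc.ne', one_div,
    ← div_eq_mul_inv, div_le_div_iff₀ hden (by norm_num : (0:ℝ) < 4)]
  linarith

/-- Norm of the Duhamel integral over `[0, τ]`, `τ = clamp T t`, for an integrand dominated by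
the heat factor times `M ‖ξ‖ e^{λ s}`: at most `M e^{λτ}/(2√(cλ))` (`integral_heat_mul_le`). [folklore] -/
theorem norm_duhamelIntegral_le_of_le (hc : 0 < c) {lam Mξ : ℝ} (hlam : 0 < lam)
    (hM : 0 ≤ Mξ) (hK₀ : Fintype.card ι < K₀) (hvc : Continuous (uncurry v))
    (hv : ∀ s, HasDecay K₀ R (v s)) (t : ℝ) (ξ : EuclideanSpace ℝ ι)
    (hN : ∀ s ∈ Icc 0 (clamp T t), ‖nonlin (v s) (v s) ξ‖ ≤ Mξ * ‖ξ‖ * Real.exp (lam * s)) :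
    ‖duhamelIntegral c T v t ξ‖ ≤ Mξ * (Real.exp (lam * clamp T t) / (2 * Real.sqrt (c * lam))) := by
  set τ := clamp T t with hτ
  have hτ0 : 0 ≤ τ := clamp_nonneg T t
  have hint := continuous_duhamel_integrand_time (c := c) hK₀ hvc hv τ ξ
  set φ : ℝ → ℝ := fun s => heat c ξ (τ - s) * (Mξ * ‖ξ‖ * Real.exp (lam * s)) with hφ
  have hφc : Continuous φ := by
    simp only [hφ]
    exact (continuous_heat_comp c continuous_const (continuous_const.sub continuous_id)).mul
      (continuous_const.mul (Real.continuous_exp.comp (continuous_const.mul continuous_id)))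
  have h1 : ‖duhamelIntegral c T v t ξ‖ ≤ ∫ s in (0 : ℝ)..τ, φ s := by
    refine intervalIntegral.norm_integral_le_of_norm_le hτ0 (Eventually.of_forall fun s hs => ?_)
      (hφc.intervalIntegrable _ _)
    rw [norm_heat_smul]
    exact mul_le_mul_of_nonneg_left (hN s ⟨hs.1.le, hs.2⟩) (heat_nonneg _ _ _)
  refine h1.trans (integral_heat_mul_le hc hlam hτ0 (norm_nonneg ξ) hM (fun s _ => ?_)
    (hφc.intervalIntegrable _ _))
  simp only [hφ, heat]
  ring_nf
  rfl

/-- **Base estimate.** If `‖a‖ ≤ (R/2)(1+‖·‖)^{-K₀}` and `‖v(s)‖ ≤ R (1+‖·‖)^{-K₀}` for all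
`s`, then on Picard's time interval `‖Φ(v)(t)‖ ≤ R (1+‖·‖)^{-K₀}` for all `t`: the quadratic
Duhamel term contributes at most `R/4` (Leray 1934, §19; Lemarié-Rieusset 2016, §8.5). [folklore] -/
theorem hasDecay_duhamel_base (hc : 0 < c) (hK₀ : Fintype.card ι < K₀) (hR : 0 ≤ R)
    (hT : T = picardTime ι c K₀ R) (ha : HasDecay K₀ (R / 2) a) (hvc : Continuous (uncurry v))
    (hv : ∀ s, HasDecay K₀ R (v s)) (t : ℝ) : HasDecay K₀ R (duhamel c T a v t) := by
  intro ξ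
  have hTpos : 0 < T := hT ▸ picardTime_pos hc K₀ R hR
  set τ := clamp T t with hτ
  have hτI := clamp_mem_Icc hTpos.le t
  have hslice : ∀ s, Continuous (v s) := fun s => hvc.uncurry_left s
  set C₀ := nonlinConst ι K₀ K₀ with hC₀
  have hC₀0 : 0 ≤ C₀ := nonlinConst_nonneg K₀ K₀
  set w := ((1 + ‖ξ‖) ^ K₀)⁻¹ with hw
  have hw0 : 0 < w := by positivity
  -- the nonlinear term
  have hN : ∀ s ∈ Icc 0 τ, ‖nonlin (v s) (v s) ξ‖ ≤ (C₀ * (2 * (R * R)) * w) * ‖ξ‖ *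
      Real.exp (1 / T * s) := by
    intro s hs
    have h := norm_nonlin_le hK₀ (hv s) (hv s) (hslice s).aestronglyMeasurable
      (hslice s).aestronglyMeasurable ξ
    have he : 1 ≤ Real.exp (1 / T * s) := Real.one_le_exp (by have := hs.1; positivity)
    calc ‖nonlin (v s) (v s) ξ‖ ≤ C₀ * (2 * (R * R)) * ‖ξ‖ * w := h
      _ = (C₀ * (2 * (R * R)) * w) * ‖ξ‖ * 1 := by ring
      _ ≤ (C₀ * (2 * (R * R)) * w) * ‖ξ‖ * Real.exp (1 / T * s) := by gcongr
  have hI := norm_duhamelIntegral_le_of_le hc (lam := 1 / T) (by positivity)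
    (by positivity) hK₀ hvc hv t ξ hN
  -- evaluate the gain at `lam = 1/T`
  have hexp : Real.exp (1 / T * τ) ≤ Real.exp 1 := by
    apply Real.exp_le_exp.2
    rw [div_mul_eq_mul_div, one_mul, div_le_one hTpos]
    exact hτI.2
  have hsqrt : 2 * Real.sqrt (c * (1 / T)) = 2 * Real.sqrt c / Real.sqrt T := by
    rw [mul_one_div, Real.sqrt_div' c hTpos.le, mul_div_assoc]
  have hθ := picard_theta_le (ι := ι) (K₀ := K₀) hc hR
  rw [← hT] at hθ
  have hsc : 0 < Real.sqrt c := Real.sqrt_pos.2 hc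
  have hsT : 0 < Real.sqrt T := Real.sqrt_pos.2 hTpos
  have hgain : Real.exp (1 / T * τ) / (2 * Real.sqrt (c * (1 / T))) ≤
      Real.exp 1 * Real.sqrt T / (2 * Real.sqrt c) := by
    rw [hsqrt, div_div_eq_mul_div]
    rw [div_le_div_iff₀ (by positivity) (by positivity)]
    have := mul_le_mul_of_nonneg_right hexp (by positivity : 0 ≤ Real.sqrt T * (2 * Real.sqrt c))
    linarith [this]
  have hquad : ‖duhamelIntegral c T v t ξ‖ ≤ R / 4 * w := by
    calc ‖duhamelIntegral c T v t ξ‖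
        ≤ (C₀ * (2 * (R * R)) * w) * (Real.exp (1 / T * τ) / (2 * Real.sqrt (c * (1 / T)))) := hI
      _ ≤ (C₀ * (2 * (R * R)) * w) * (Real.exp 1 * Real.sqrt T / (2 * Real.sqrt c)) := by
          gcongr
      _ = R * w * (Real.exp 1 * C₀ * R * Real.sqrt T / Real.sqrt c) := by ring
      _ ≤ R * w * (1 / 4) := by gcongr
      _ = R / 4 * w := by ring
  -- the heat part
  have hheat : ‖heat c ξ τ • a ξ‖ ≤ R / 2 * w := by
    rw [norm_heat_smul]
    calc heat c ξ τ * ‖a ξ‖ ≤ 1 * (R / 2 * w) :=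
          mul_le_mul (heat_le_one hc.le hτI.1 ξ) (ha ξ) (norm_nonneg _) zero_le_one
      _ = R / 2 * w := one_mul _
  calc ‖duhamel c T a v t ξ‖ ≤ ‖heat c ξ τ • a ξ‖ + ‖duhamelIntegral c T v t ξ‖ := norm_sub_le _ _
    _ ≤ R / 2 * w + R / 4 * w := add_le_add hheat hquad
    _ ≤ R * w := by nlinarith

/-- **Contraction.** On Picard's interval, for `v`, `w` in the ball of radius `R` with
`‖v(s) − w(s)‖ ≤ D (1+‖·‖)^{-K₀}` for all `s`: `‖Φ(v)(t) − Φ(w)(t)‖ ≤ (D/2)(1+‖·‖)^{-K₀}`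
(`N(v,v) − N(w,w) = N(v−w,v) + N(w,v−w)`; Leray 1934, §19; Lemarié-Rieusset 2016, §8.5). [folklore] -/
theorem hasDecay_duhamel_sub (hc : 0 < c) (hK₀ : Fintype.card ι < K₀) (hR : 0 ≤ R)
    (hT : T = picardTime ι c K₀ R) (hvc : Continuous (uncurry v)) (hwc : Continuous (uncurry w))
    (hv : ∀ s, HasDecay K₀ R (v s)) (hw : ∀ s, HasDecay K₀ R (w s))
    (hd : ∀ s, HasDecay K₀ D (v s - w s)) (t : ℝ) :
    HasDecay K₀ (D / 2) (duhamel c T a v t - duhamel c T a w t) := by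
  intro ξ
  have hTpos : 0 < T := hT ▸ picardTime_pos hc K₀ R hR
  have hD : 0 ≤ D := (hd 0).nonneg
  set τ := clamp T t with hτ
  have hτI := clamp_mem_Icc hTpos.le t
  have hvs : ∀ s, Continuous (v s) := fun s => hvc.uncurry_left s
  have hws : ∀ s, Continuous (w s) := fun s => hwc.uncurry_left s
  set C₀ := nonlinConst ι K₀ K₀ with hC₀
  have hC₀0 : 0 ≤ C₀ := nonlinConst_nonneg K₀ K₀
  set wt := ((1 + ‖ξ‖) ^ K₀)⁻¹ with hwt
  have hw0 : 0 < wt := by positivity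
  -- the difference is the difference of the Duhamel integrals
  have hiv := continuous_duhamel_integrand_time (c := c) hK₀ hvc hv τ ξ
  have hiw := continuous_duhamel_integrand_time (c := c) hK₀ hwc hw τ ξ
  have hdiff : duhamel c T a v t ξ - duhamel c T a w t ξ =
      ∫ s in (0 : ℝ)..τ, heat c ξ (τ - s) • (nonlin (w s) (w s) ξ - nonlin (v s) (v s) ξ) := by
    simp only [duhamel, ← hτ]
    rw [sub_sub_sub_cancel_left, ← intervalIntegral.integral_sub (hiw.intervalIntegrable _ _)
      (hiv.intervalIntegrable _ _)]
    congr 1 with s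
    rw [smul_sub]
  have hNdiff : ∀ s, ‖nonlin (v s) (v s) ξ - nonlin (w s) (w s) ξ‖ ≤
      C₀ * (4 * (R * D)) * ‖ξ‖ * wt := by
    intro s
    rw [nonlin_self_sub_self hK₀ (hv s) (hw s) (hvs s).aestronglyMeasurable
      (hws s).aestronglyMeasurable]
    have hdm : AEStronglyMeasurable (v s - w s) volume :=
      ((hvs s).sub (hws s)).aestronglyMeasurable
    have h1 := norm_nonlin_le hK₀ (hd s) (hv s) hdm (hvs s).aestronglyMeasurable ξ
    have h2 := norm_nonlin_le hK₀ (hw s) (hd s) (hws s).aestronglyMeasurable hdm ξ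
    calc ‖nonlin (v s - w s) (v s) ξ + nonlin (w s) (v s - w s) ξ‖
        ≤ ‖nonlin (v s - w s) (v s) ξ‖ + ‖nonlin (w s) (v s - w s) ξ‖ := norm_add_le _ _
      _ ≤ C₀ * (2 * (D * R)) * ‖ξ‖ * wt + C₀ * (2 * (R * D)) * ‖ξ‖ * wt := add_le_add h1 h2
      _ = C₀ * (4 * (R * D)) * ‖ξ‖ * wt := by ring
  -- bound the integral exactly as in the base estimate
  have hτ0 : 0 ≤ τ := clamp_nonneg T t
  set Mξ := C₀ * (4 * (R * D)) * wt with hMξ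
  set φ : ℝ → ℝ := fun s => Real.exp (-(c * ‖ξ‖ ^ 2) * (τ - s)) * (Mξ * ‖ξ‖ *
    Real.exp (1 / T * s)) with hφ
  have hφc : Continuous φ := by
    simp only [hφ]
    exact (continuous_heat_comp c continuous_const (continuous_const.sub continuous_id)).mul
      (continuous_const.mul (Real.continuous_exp.comp (continuous_const.mul continuous_id)))
  have h1 : ‖duhamel c T a v t ξ - duhamel c T a w t ξ‖ ≤ ∫ s in (0 : ℝ)..τ, φ s := by
    rw [hdiff]
    refine intervalIntegral.norm_integral_le_of_norm_le hτ0 (Eventually.of_forall fun s hs => ?_)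
      (hφc.intervalIntegrable _ _)
    rw [norm_heat_smul, norm_sub_rev]
    refine mul_le_mul_of_nonneg_left ?_ (heat_nonneg _ _ _)
    have he : 1 ≤ Real.exp (1 / T * s) := Real.one_le_exp (by have := hs.1; positivity)
    calc ‖nonlin (v s) (v s) ξ - nonlin (w s) (w s) ξ‖ ≤ C₀ * (4 * (R * D)) * ‖ξ‖ * wt := hNdiff s
      _ = Mξ * ‖ξ‖ * 1 := by simp only [hMξ]; ring
      _ ≤ Mξ * ‖ξ‖ * Real.exp (1 / T * s) := by gcongr
  have h2 : ∫ s in (0 : ℝ)..τ, φ s ≤ Mξ * (Real.exp (1 / T * τ) / (2 * Real.sqrt (c * (1 / T)))) :=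
    integral_heat_mul_le (t := τ) hc (by positivity) hτ0 (norm_nonneg ξ) (by positivity)
      (fun s _ => le_rfl) (hφc.intervalIntegrable _ _)
  have hexp : Real.exp (1 / T * τ) ≤ Real.exp 1 := by
    apply Real.exp_le_exp.2
    rw [div_mul_eq_mul_div, one_mul, div_le_one hTpos]
    exact hτI.2
  have hsqrt : 2 * Real.sqrt (c * (1 / T)) = 2 * Real.sqrt c / Real.sqrt T := by
    rw [mul_one_div, Real.sqrt_div' c hTpos.le, mul_div_assoc]
  have hθ := picard_theta_le (ι := ι) (K₀ := K₀) hc hR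
  rw [← hT] at hθ
  have hsc : 0 < Real.sqrt c := Real.sqrt_pos.2 hc
  have hsT : 0 < Real.sqrt T := Real.sqrt_pos.2 hTpos
  have hgain : Real.exp (1 / T * τ) / (2 * Real.sqrt (c * (1 / T))) ≤
      Real.exp 1 * Real.sqrt T / (2 * Real.sqrt c) := by
    rw [hsqrt, div_div_eq_mul_div]
    rw [div_le_div_iff₀ (by positivity) (by positivity)]
    have := mul_le_mul_of_nonneg_right hexp (by positivity : 0 ≤ Real.sqrt T * (2 * Real.sqrt c))
    linarith [this]
  calc ‖(duhamel c T a v t - duhamel c T a w t) ξ‖ = ‖duhamel c T a v t ξ - duhamel c T a w t ξ‖ := rfl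
    _ ≤ Mξ * (Real.exp (1 / T * τ) / (2 * Real.sqrt (c * (1 / T)))) := h1.trans h2
    _ ≤ Mξ * (Real.exp 1 * Real.sqrt T / (2 * Real.sqrt c)) := by gcongr
    _ = D * wt * (2 * (Real.exp 1 * C₀ * R * Real.sqrt T / Real.sqrt c)) := by
        simp only [hMξ]; ring
    _ ≤ D * wt * (2 * (1 / 4)) := by gcongr
    _ = D / 2 * wt := by ring

/-! #### Propagation of higher decay -/

/-- The time-weight rate `λ_K = (4 C_K² R² + 1)/c`, `C_K = nonlinConst ι K K₀`, at which the
order-`K` estimate closes on the *same* interval. [folklore] -/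
def highRate (ι : Type*) [Fintype ι] (c : ℝ) (K K₀ : ℕ) (R : ℝ) : ℝ :=
  (4 * (nonlinConst ι K K₀ * R) ^ 2 + 1) / c

omit [DecidableEq ι] in
/-- `λ_K > 0`. [folklore] -/
theorem highRate_pos (hc : 0 < c) (K K₀ : ℕ) (R : ℝ) : 0 < highRate ι c K K₀ R := by
  unfold highRate; positivity

omit [DecidableEq ι] in
/-- The numerical fact behind `λ_K`: `C_K R / √(c λ_K) ≤ 1/2`. [folklore] -/
theorem highRate_key (hc : 0 < c) (hR : 0 ≤ R) (K K₀ : ℕ) :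
    nonlinConst ι K K₀ * R / Real.sqrt (c * highRate ι c K K₀ R) ≤ 1 / 2 := by
  have hC := nonlinConst_nonneg (ι := ι) K K₀
  set x := nonlinConst ι K K₀ * R with hx
  have hx0 : 0 ≤ x := by positivity
  have h1 : c * highRate ι c K K₀ R = 4 * x ^ 2 + 1 := by
    unfold highRate
    rw [mul_div_cancel₀ _ hc.ne', hx]
  rw [h1]
  have h4 : (0 : ℝ) ≤ 4 * x ^ 2 + 1 := by positivity
  have hs : 0 < Real.sqrt (4 * x ^ 2 + 1) := Real.sqrt_pos.2 (by positivity)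
  rw [div_le_div_iff₀ hs (by norm_num : (0:ℝ) < 2), one_mul]
  have h2 : 2 * x ≤ Real.sqrt (4 * x ^ 2 + 1) := by
    have h3 : (2 * x) ^ 2 ≤ 4 * x ^ 2 + 1 := by nlinarith
    calc 2 * x = Real.sqrt ((2 * x) ^ 2) := (Real.sqrt_sq (by positivity)).symm
      _ ≤ Real.sqrt (4 * x ^ 2 + 1) := Real.sqrt_le_sqrt h3
  linarith

/-- **Propagation of order-`K` decay.** If `a` decays to order `K` with constant `A`, `v` stays
in the order-`K₀` ball of radius `R` and satisfies the weighted order-`K` bound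
`‖v(s,η)‖ ≤ 2A e^{λ_K clamp(s)} (1+‖η‖)^{-K}`, then so does `Φ(v)`: the linear-in-the-high-norm
structure of the convolution estimate and the heat gain `λ_K^{-1/2}` close the bound on the
unchanged interval `[0, T]` (Lemarié-Rieusset 2016, §8.5, persistence of regularity). [folklore] -/
theorem hasDecay_duhamel_high (hc : 0 < c) (hK₀ : Fintype.card ι < K₀) (hT : 0 < T) (hR : 0 ≤ R)
    (haK : HasDecay K A a) (hvc : Continuous (uncurry v)) (hv : ∀ s, HasDecay K₀ R (v s))
    (hvK : ∀ s, HasDecay K (2 * A * Real.exp (highRate ι c K K₀ R * clamp T s)) (v s)) (t : ℝ) :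
    HasDecay K (2 * A * Real.exp (highRate ι c K K₀ R * clamp T t)) (duhamel c T a v t) := by
  intro ξ
  have hA : 0 ≤ A := haK.nonneg
  set lam := highRate ι c K K₀ R with hlam
  have hlam0 : 0 < lam := highRate_pos hc K K₀ R
  set τ := clamp T t with hτ
  have hτI := clamp_mem_Icc hT.le t
  have hslice : ∀ s, Continuous (v s) := fun s => hvc.uncurry_left s
  set CK := nonlinConst ι K K₀ with hCK
  have hCK0 : 0 ≤ CK := nonlinConst_nonneg K K₀
  set wK := ((1 + ‖ξ‖) ^ K)⁻¹ with hwK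
  have hwK0 : 0 < wK := by positivity
  -- the nonlinear term along `[0, τ]`, where `clamp T s = s`
  have hN : ∀ s ∈ Icc 0 τ, ‖nonlin (v s) (v s) ξ‖ ≤ (CK * (4 * A * R) * wK) * ‖ξ‖ *
      Real.exp (lam * s) := by
    intro s hs
    have hsI : s ∈ Icc 0 T := ⟨hs.1, hs.2.trans hτI.2⟩
    have hcl : clamp T s = s := clamp_of_mem hsI
    have hvKs := hvK s
    rw [hcl] at hvKs
    have h := norm_nonlin_le_mixed hK₀ (hv s) hvKs (hv s) hvKs (hslice s).aestronglyMeasurable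
      (hslice s).aestronglyMeasurable ξ
    calc ‖nonlin (v s) (v s) ξ‖ ≤ CK * (2 * A * Real.exp (lam * s) * R +
          R * (2 * A * Real.exp (lam * s))) * ‖ξ‖ * wK := h
      _ = (CK * (4 * A * R) * wK) * ‖ξ‖ * Real.exp (lam * s) := by ring
  have hI := norm_duhamelIntegral_le_of_le hc hlam0 (by positivity) hK₀ hvc hv t ξ hN
  have hkey := highRate_key (ι := ι) hc hR K K₀
  rw [← hlam, ← hCK] at hkey
  have hs0 : 0 < Real.sqrt (c * lam) := Real.sqrt_pos.2 (by positivity)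
  have hquad : ‖duhamelIntegral c T v t ξ‖ ≤ A * Real.exp (lam * τ) * wK := by
    calc ‖duhamelIntegral c T v t ξ‖
        ≤ (CK * (4 * A * R) * wK) * (Real.exp (lam * τ) / (2 * Real.sqrt (c * lam))) := hI
      _ = A * Real.exp (lam * τ) * wK * (2 * (CK * R / Real.sqrt (c * lam))) := by
          ring
      _ ≤ A * Real.exp (lam * τ) * wK * (2 * (1 / 2)) := by gcongr
      _ = A * Real.exp (lam * τ) * wK := by ring
  have hheat : ‖heat c ξ τ • a ξ‖ ≤ A * Real.exp (lam * τ) * wK := by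
    rw [norm_heat_smul]
    have he : 1 ≤ Real.exp (lam * τ) := Real.one_le_exp (by have := hτI.1; positivity)
    calc heat c ξ τ * ‖a ξ‖ ≤ 1 * (A * wK) :=
          mul_le_mul (heat_le_one hc.le hτI.1 ξ) (haK ξ) (norm_nonneg _) zero_le_one
      _ = A * 1 * wK := by ring
      _ ≤ A * Real.exp (lam * τ) * wK := by gcongr
  calc ‖duhamel c T a v t ξ‖ ≤ ‖heat c ξ τ • a ξ‖ + ‖duhamelIntegral c T v t ξ‖ := norm_sub_le _ _
    _ ≤ A * Real.exp (lam * τ) * wK + A * Real.exp (lam * τ) * wK := add_le_add hheat hquad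
    _ = 2 * A * Real.exp (lam * τ) * wK := by ring

/-! #### Incompressibility and conjugation symmetry -/

/-- The Duhamel integrand is interval integrable. [folklore] -/
theorem intervalIntegrable_duhamel_integrand (hK₀ : Fintype.card ι < K₀)
    (hvc : Continuous (uncurry v)) (hv : ∀ s, HasDecay K₀ R (v s)) (τ : ℝ)
    (ξ : EuclideanSpace ℝ ι) (a b : ℝ) :
    IntervalIntegrable (fun s : ℝ => heat c ξ (τ - s) • nonlin (v s) (v s) ξ) volume a b :=
  (continuous_duhamel_integrand_time hK₀ hvc hv τ ξ).intervalIntegrable a b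

/-- Components of the Duhamel integral. [folklore] -/
theorem duhamelIntegral_apply (hK₀ : Fintype.card ι < K₀) (hvc : Continuous (uncurry v))
    (hv : ∀ s, HasDecay K₀ R (v s)) (t : ℝ) (ξ : EuclideanSpace ℝ ι) (l : ι) :
    duhamelIntegral c T v t ξ l =
      ∫ s in (0 : ℝ)..clamp T t, heat c ξ (clamp T t - s) * nonlin (v s) (v s) ξ l := by
  have h := ((ContinuousLinearMap.proj (R := ℝ) (φ := fun _ : ι => ℂ) l).intervalIntegral_comp_comm
    (intervalIntegrable_duhamel_integrand (c := c) hK₀ hvc hv (clamp T t) ξ 0 (clamp T t)))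
  simp only [ContinuousLinearMap.proj_apply, Pi.smul_apply, Complex.real_smul] at h
  rw [duhamelIntegral, ← h]

/-- **`Φ(v)` is divergence free** on the Fourier side when the datum is:
`∑ₗ ξₗ Φ(v)(t,ξ)_l = 0` (`∑ₗ ξₗ N_l = 0`, `sum_mul_nonlin`). [folklore] -/
theorem sum_mul_duhamel (hK₀ : Fintype.card ι < K₀) (hvc : Continuous (uncurry v))
    (hv : ∀ s, HasDecay K₀ R (v s)) (hdiv : ∀ ξ, ∑ l, (ξ l : ℂ) * a ξ l = 0) (t : ℝ)
    (ξ : EuclideanSpace ℝ ι) : ∑ l, (ξ l : ℂ) * duhamel c T a v t ξ l = 0 := by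
  simp only [duhamel_eq, Pi.sub_apply, Pi.smul_apply, Complex.real_smul, mul_sub,
    Finset.sum_sub_distrib]
  have h1 : ∑ l, (ξ l : ℂ) * ((heat c ξ (clamp T t) : ℂ) * a ξ l) = 0 := by
    calc ∑ l, (ξ l : ℂ) * ((heat c ξ (clamp T t) : ℂ) * a ξ l)
        = (heat c ξ (clamp T t) : ℂ) * ∑ l, (ξ l : ℂ) * a ξ l := by
          rw [Finset.mul_sum]; congr 1 with l; ring
      _ = 0 := by rw [hdiv, mul_zero]
  have hii : ∀ l, IntervalIntegrable (fun s => (ξ l : ℂ) * (heat c ξ (clamp T t - s) *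
      nonlin (v s) (v s) ξ l)) volume 0 (clamp T t) := fun l => by
    have := ((continuous_apply l).comp (continuous_duhamel_integrand_time (c := c) hK₀ hvc hv
      (clamp T t) ξ)).const_smul (ξ l : ℂ)
    refine (this.intervalIntegrable _ _).congr fun s _ => ?_
    simp [Complex.real_smul]
  have hz : ∀ s, ∑ l, (ξ l : ℂ) * ((heat c ξ (clamp T t - s) : ℂ) * nonlin (v s) (v s) ξ l) = 0 :=
    fun s => by
    calc ∑ l, (ξ l : ℂ) * ((heat c ξ (clamp T t - s) : ℂ) * nonlin (v s) (v s) ξ l)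
        = (heat c ξ (clamp T t - s) : ℂ) * ∑ l, (ξ l : ℂ) * nonlin (v s) (v s) ξ l := by
          rw [Finset.mul_sum]; congr 1 with l; ring
      _ = 0 := by rw [sum_mul_nonlin, mul_zero]
  have h2 : ∑ l, (ξ l : ℂ) * duhamelIntegral c T v t ξ l = 0 := by
    simp_rw [duhamelIntegral_apply hK₀ hvc hv, ← intervalIntegral.integral_const_mul]
    rw [← intervalIntegral.integral_finsetSum fun l _ => hii l]
    have : (fun s => ∑ l, (ξ l : ℂ) * ((heat c ξ (clamp T t - s) : ℂ) * nonlin (v s) (v s) ξ l)) =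
        fun _ => (0 : ℂ) := funext hz
    rw [this, intervalIntegral.integral_zero]
  rw [h1, h2, sub_zero]

/-- **Conjugation symmetry of `Φ(v)`**: if `a(-ξ) = conj a(ξ)` and `v(s,-ξ) = conj v(s,ξ)`
componentwise, then `Φ(v)(t,-ξ) = conj Φ(v)(t,ξ)` (the heat factor is real and even;
`nonlin_conj_symm`; `intervalIntegral_conj`). [folklore] -/
theorem duhamel_conj_symm (hK₀ : Fintype.card ι < K₀) (hvc : Continuous (uncurry v))
    (hv : ∀ s, HasDecay K₀ R (v s)) (ha : ∀ ξ l, a (-ξ) l = conj (a ξ l))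
    (hvs : ∀ s ξ l, v s (-ξ) l = conj (v s ξ l)) (t : ℝ) (ξ : EuclideanSpace ℝ ι) (l : ι) :
    duhamel c T a v t (-ξ) l = conj (duhamel c T a v t ξ l) := by
  simp only [duhamel_eq, Pi.sub_apply, Pi.smul_apply, Complex.real_smul, map_sub, map_mul,
    Complex.conj_ofReal, heat_neg, ha]
  congr 1
  rw [duhamelIntegral_apply hK₀ hvc hv, duhamelIntegral_apply hK₀ hvc hv, ← intervalIntegral.intervalIntegral_conj]
  congr 1 with s
  rw [map_mul, Complex.conj_ofReal, heat_neg, nonlin_conj_symm (hvs s) (hvs s)]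

end Duhamel

/-! ### The iteration and its limit -/

section Iteration

variable {ι : Type*} [Fintype ι] [DecidableEq ι]

/-- The Picard iterates `v₀(t) = e^{-c‖ξ‖² clamp(t)} a`, `v_{n+1} = Φ(v_n)` (Leray 1934, §19,
successive approximations). [folklore] -/
def picardIter (c T : ℝ) (a : EuclideanSpace ℝ ι → ι → ℂ) : ℕ → ℝ → EuclideanSpace ℝ ι → ι → ℂ
  | 0 => fun t ξ => heat c ξ (clamp T t) • a ξ
  | n + 1 => duhamel c T a (picardIter c T a n)

/-- The hypotheses of the iteration: `c > 0`, `K₀ > card ι`, continuous data with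
`‖a‖ ≤ (R/2)(1+‖·‖)^{-K₀}`. [folklore] -/
structure PicardHyp (c : ℝ) (K₀ : ℕ) (R : ℝ) (a : EuclideanSpace ℝ ι → ι → ℂ) : Prop where
  /-- positivity of the viscosity rate `c = 4π²ν` -/
  hc : 0 < c
  /-- the weights of order `K₀` are integrable -/
  hK₀ : Fintype.card ι < K₀
  /-- the datum is continuous -/
  cont : Continuous a
  /-- the datum lies in the ball of radius `R/2` -/
  decay : HasDecay K₀ (R / 2) a

variable {c T : ℝ} {K₀ : ℕ} {R : ℝ} {a : EuclideanSpace ℝ ι → ι → ℂ}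

omit [DecidableEq ι] in
/-- `R ≥ 0`. [folklore] -/
theorem PicardHyp.R_nonneg (h : PicardHyp c K₀ R a) : 0 ≤ R := by
  have := h.decay.nonneg; linarith

omit [DecidableEq ι] in
/-- Picard's time is positive. [folklore] -/
theorem PicardHyp.time_pos (h : PicardHyp c K₀ R a) : 0 < picardTime ι c K₀ R :=
  picardTime_pos h.hc K₀ R h.R_nonneg

/-- **Every iterate is jointly continuous and stays in the ball of radius `R`.** [folklore] -/
theorem PicardHyp.iter_continuous_decay (h : PicardHyp c K₀ R a) (hT : T = picardTime ι c K₀ R)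
    (n : ℕ) : Continuous (uncurry (picardIter c T a n)) ∧ ∀ t, HasDecay K₀ R (picardIter c T a n t) := by
  induction n with
  | zero =>
    refine ⟨?_, fun t ξ => ?_⟩
    · exact (continuous_heat_comp c continuous_snd ((continuous_clamp T).comp continuous_fst)).smul
        (h.cont.comp continuous_snd)
    · have hτ := clamp_mem_Icc (hT ▸ h.time_pos).le t
      change ‖heat c ξ (clamp T t) • a ξ‖ ≤ _
      rw [norm_heat_smul]
      calc heat c ξ (clamp T t) * ‖a ξ‖ ≤ 1 * (R / 2 * ((1 + ‖ξ‖) ^ K₀)⁻¹) :=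
            mul_le_mul (heat_le_one h.hc.le hτ.1 ξ) (h.decay ξ) (norm_nonneg _) zero_le_one
        _ ≤ R * ((1 + ‖ξ‖) ^ K₀)⁻¹ := by
            rw [one_mul]; gcongr; linarith [h.R_nonneg]
  | succ n ih =>
    exact ⟨continuous_duhamel h.hK₀ h.cont ih.1 ih.2,
      hasDecay_duhamel_base h.hc h.hK₀ h.R_nonneg hT h.decay ih.1 ih.2⟩

/-- Joint continuity of the iterates. [folklore] -/
theorem PicardHyp.continuous_iter (h : PicardHyp c K₀ R a) (hT : T = picardTime ι c K₀ R) (n : ℕ) :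
    Continuous (uncurry (picardIter c T a n)) := (h.iter_continuous_decay hT n).1

/-- The iterates stay in the ball of radius `R`. [folklore] -/
theorem PicardHyp.decay_iter (h : PicardHyp c K₀ R a) (hT : T = picardTime ι c K₀ R) (n : ℕ) (t : ℝ) :
    HasDecay K₀ R (picardIter c T a n t) := (h.iter_continuous_decay hT n).2 t

/-- **Geometric convergence**: `‖v_{n+1}(t) − v_n(t)‖ ≤ 2R 2^{-n} (1+‖·‖)^{-K₀}`. [folklore] -/
theorem PicardHyp.decay_iter_sub (h : PicardHyp c K₀ R a) (hT : T = picardTime ι c K₀ R) (n : ℕ)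
    (t : ℝ) : HasDecay K₀ (2 * R * (1 / 2) ^ n) (picardIter c T a (n + 1) t - picardIter c T a n t) := by
  induction n generalizing t with
  | zero =>
    have h1 := h.decay_iter hT 1 t
    have h0 := h.decay_iter hT 0 t
    simpa [two_mul] using h1.sub h0
  | succ n ih =>
    have := hasDecay_duhamel_sub (a := a) h.hc h.hK₀ h.R_nonneg hT (h.continuous_iter hT (n + 1))
      (h.continuous_iter hT n) (h.decay_iter hT (n + 1)) (h.decay_iter hT n) ih t
    change HasDecay K₀ _ (duhamel c T a (picardIter c T a (n + 1)) t -
      duhamel c T a (picardIter c T a n) t)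
    convert this using 2
    rw [pow_succ]; ring

/-- The iterates form a Cauchy sequence at every point. [folklore] -/
theorem PicardHyp.dist_iter_le (h : PicardHyp c K₀ R a) (hT : T = picardTime ι c K₀ R) (t : ℝ)
    (ξ : EuclideanSpace ℝ ι) (n : ℕ) :
    dist (picardIter c T a n t ξ) (picardIter c T a (n + 1) t ξ) ≤
      2 * R * ((1 + ‖ξ‖) ^ K₀)⁻¹ * (1 / 2) ^ n := by
  rw [dist_comm, dist_eq_norm]
  have := h.decay_iter_sub hT n t ξ
  calc ‖picardIter c T a (n + 1) t ξ - picardIter c T a n t ξ‖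
      = ‖(picardIter c T a (n + 1) t - picardIter c T a n t) ξ‖ := rfl
    _ ≤ 2 * R * (1 / 2) ^ n * ((1 + ‖ξ‖) ^ K₀)⁻¹ := this
    _ = 2 * R * ((1 + ‖ξ‖) ^ K₀)⁻¹ * (1 / 2) ^ n := by ring

/-- The pointwise Cauchy property. [folklore] -/
theorem PicardHyp.cauchySeq_iter (h : PicardHyp c K₀ R a) (hT : T = picardTime ι c K₀ R) (t : ℝ)
    (ξ : EuclideanSpace ℝ ι) : CauchySeq fun n => picardIter c T a n t ξ :=
  cauchySeq_of_le_geometric (1 / 2) _ (by norm_num) (h.dist_iter_le hT t ξ)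

/-- **The Picard limit** `v(t, ξ) = lim_n v_n(t, ξ)` (pointwise; Leray 1934, §19). [folklore] -/
def picardLimit (c T : ℝ) (a : EuclideanSpace ℝ ι → ι → ℂ) (t : ℝ) (ξ : EuclideanSpace ℝ ι) : ι → ℂ :=
  limUnder atTop fun n => picardIter c T a n t ξ

/-- The iterates converge to the limit. [folklore] -/
theorem PicardHyp.tendsto_iter (h : PicardHyp c K₀ R a) (hT : T = picardTime ι c K₀ R) (t : ℝ)
    (ξ : EuclideanSpace ℝ ι) :
    Tendsto (fun n => picardIter c T a n t ξ) atTop (𝓝 (picardLimit c T a t ξ)) :=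
  (h.cauchySeq_iter hT t ξ).tendsto_limUnder

/-- **Rate of convergence**: `‖v_n(t,ξ) − v(t,ξ)‖ ≤ 4R 2^{-n} (1+‖ξ‖)^{-K₀}`. [folklore] -/
theorem PicardHyp.norm_iter_sub_limit_le (h : PicardHyp c K₀ R a) (hT : T = picardTime ι c K₀ R)
    (n : ℕ) (t : ℝ) (ξ : EuclideanSpace ℝ ι) :
    ‖picardIter c T a n t ξ - picardLimit c T a t ξ‖ ≤ 4 * R * (1 / 2) ^ n * ((1 + ‖ξ‖) ^ K₀)⁻¹ := by
  have := dist_le_of_le_geometric_of_tendsto (r := 1 / 2) (C := 2 * R * ((1 + ‖ξ‖) ^ K₀)⁻¹)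
    (by norm_num) (h.dist_iter_le hT t ξ) (h.tendsto_iter hT t ξ) n
  rw [dist_eq_norm] at this
  convert this using 1
  norm_num; ring

/-- **The limit stays in the ball**: `‖v(t)‖ ≤ R (1+‖·‖)^{-K₀}`. [folklore] -/
theorem PicardHyp.decay_limit (h : PicardHyp c K₀ R a) (hT : T = picardTime ι c K₀ R) (t : ℝ) :
    HasDecay K₀ R (picardLimit c T a t) := fun ξ =>
  le_of_tendsto ((continuous_norm.tendsto _).comp (h.tendsto_iter hT t ξ))
    (Eventually.of_forall fun n => h.decay_iter hT n t ξ)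

/-- Decay bounds pass to the limit in general: if every iterate satisfies
`‖v_n(t,ξ)‖ ≤ B` then `‖v(t,ξ)‖ ≤ B`. [folklore] -/
theorem PicardHyp.norm_limit_le_of_iter (h : PicardHyp c K₀ R a) (hT : T = picardTime ι c K₀ R)
    {t : ℝ} {ξ : EuclideanSpace ℝ ι} {B : ℝ} (hB : ∀ n, ‖picardIter c T a n t ξ‖ ≤ B) :
    ‖picardLimit c T a t ξ‖ ≤ B :=
  le_of_tendsto ((continuous_norm.tendsto _).comp (h.tendsto_iter hT t ξ)) (Eventually.of_forall hB)

/-- The convergence is uniform on `ℝ × E`. [folklore] -/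
theorem PicardHyp.tendstoUniformly_iter (h : PicardHyp c K₀ R a) (hT : T = picardTime ι c K₀ R) :
    TendstoUniformly (fun n => uncurry (picardIter c T a n)) (uncurry (picardLimit c T a)) atTop := by
  rw [Metric.tendstoUniformly_iff]
  intro ε hε
  have hR := h.R_nonneg
  obtain ⟨N, hN⟩ : ∃ N : ℕ, 4 * R * (1 / 2 : ℝ) ^ N < ε := by
    have : Tendsto (fun n : ℕ => 4 * R * (1 / 2 : ℝ) ^ n) atTop (𝓝 (4 * R * 0)) :=
      (tendsto_pow_atTop_nhds_zero_of_lt_one (by norm_num) (by norm_num)).const_mul _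
    rw [mul_zero] at this
    exact (this.eventually (gt_mem_nhds hε)).exists
  refine eventually_atTop.2 ⟨N, fun n hn p => ?_⟩
  rw [dist_comm, dist_eq_norm]
  have hpow : (1 / 2 : ℝ) ^ n ≤ (1 / 2) ^ N := pow_le_pow_of_le_one (by norm_num) (by norm_num) hn
  calc ‖uncurry (picardIter c T a n) p - uncurry (picardLimit c T a) p‖
      ≤ 4 * R * (1 / 2) ^ n * ((1 + ‖p.2‖) ^ K₀)⁻¹ := h.norm_iter_sub_limit_le hT n p.1 p.2
    _ ≤ 4 * R * (1 / 2) ^ n * 1 :=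
        mul_le_mul_of_nonneg_left (inv_one_add_norm_pow_le_one _ _) (by positivity)
    _ ≤ 4 * R * (1 / 2) ^ N * 1 := by
        rw [mul_one, mul_one]; exact mul_le_mul_of_nonneg_left hpow (by positivity)
    _ < ε := by rw [mul_one]; exact hN

/-- **The limit is jointly continuous** (uniform limit of continuous maps). [folklore] -/
theorem PicardHyp.continuous_limit (h : PicardHyp c K₀ R a) (hT : T = picardTime ι c K₀ R) :
    Continuous (uncurry (picardLimit c T a)) :=
  (h.tendstoUniformly_iter hT).continuous (Frequently.of_forall fun n => h.continuous_iter hT n)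

/-- Time slices of the limit are continuous, hence measurable. [folklore] -/
theorem PicardHyp.continuous_limit_slice (h : PicardHyp c K₀ R a) (hT : T = picardTime ι c K₀ R)
    (t : ℝ) : Continuous (picardLimit c T a t) :=
  (h.continuous_limit hT).uncurry_left t

/-- **The limit is a fixed point of the Duhamel map**: `v = Φ(v)` identically on `ℝ × E`
(`‖Φ(v) − v‖ ≤ ‖Φ(v) − Φ(v_n)‖ + ‖v_{n+1} − v‖ → 0`). [folklore] -/
theorem PicardHyp.fixed (h : PicardHyp c K₀ R a) (hT : T = picardTime ι c K₀ R) (t : ℝ)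
    (ξ : EuclideanSpace ℝ ι) : picardLimit c T a t ξ = duhamel c T a (picardLimit c T a) t ξ := by
  have hR := h.R_nonneg
  set v := picardLimit c T a with hv
  -- `‖Φ(v)(t,ξ) − v(t,ξ)‖ ≤ ε` for every `ε > 0`
  refine eq_of_norm_sub_le_zero (le_of_forall_pos_le_add fun ε hε => ?_) |>.symm
  rw [zero_add]
  obtain ⟨n, hn⟩ : ∃ n : ℕ, 8 * R * (1 / 2 : ℝ) ^ n < ε := by
    have : Tendsto (fun n : ℕ => 8 * R * (1 / 2 : ℝ) ^ n) atTop (𝓝 (8 * R * 0)) :=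
      (tendsto_pow_atTop_nhds_zero_of_lt_one (by norm_num) (by norm_num)).const_mul _
    rw [mul_zero] at this
    exact (this.eventually (gt_mem_nhds hε)).exists
  -- distance of `v` to the `n`-th iterate, as a decay bound
  have hd : ∀ s, HasDecay K₀ (4 * R * (1 / 2) ^ n) (picardIter c T a n s - v s) := fun s η =>
    h.norm_iter_sub_limit_le hT n s η
  have hΦ := hasDecay_duhamel_sub (a := a) h.hc h.hK₀ hR hT (h.continuous_iter hT n)
    (h.continuous_limit hT) (h.decay_iter hT n) (h.decay_limit hT) hd t ξ
  have hstep := h.norm_iter_sub_limit_le hT (n + 1) t ξ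
  have hw1 := inv_one_add_norm_pow_le_one ξ K₀
  calc ‖duhamel c T a v t ξ - v t ξ‖
      ≤ ‖duhamel c T a v t ξ - picardIter c T a (n + 1) t ξ‖ +
          ‖picardIter c T a (n + 1) t ξ - v t ξ‖ := norm_sub_le_norm_sub_add_norm_sub _ _ _
    _ = ‖(duhamel c T a (picardIter c T a n) t - duhamel c T a v t) ξ‖ +
          ‖picardIter c T a (n + 1) t ξ - v t ξ‖ := by
        rw [Pi.sub_apply, norm_sub_rev]; rfl
    _ ≤ 4 * R * (1 / 2) ^ n / 2 * ((1 + ‖ξ‖) ^ K₀)⁻¹ +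
          4 * R * (1 / 2) ^ (n + 1) * ((1 + ‖ξ‖) ^ K₀)⁻¹ := add_le_add hΦ hstep
    _ ≤ 4 * R * (1 / 2) ^ n / 2 * 1 + 4 * R * (1 / 2) ^ (n + 1) * 1 := by gcongr
    _ = 4 * R * (1 / 2) ^ n := by rw [pow_succ]; ring
    _ ≤ ε := by nlinarith [pow_nonneg (by norm_num : (0:ℝ) ≤ 1 / 2) n]

/-- The limit only sees clamped time: `v(t) = v(clamp T t)`. [folklore] -/
theorem PicardHyp.limit_clamp (h : PicardHyp c K₀ R a) (hT : T = picardTime ι c K₀ R) (t : ℝ)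
    (ξ : EuclideanSpace ℝ ι) : picardLimit c T a (clamp T t) ξ = picardLimit c T a t ξ := by
  rw [h.fixed hT, h.fixed hT t, duhamel_clamp (hT ▸ h.time_pos).le]

/-- **Initial value**: `v(0) = a`. [folklore] -/
theorem PicardHyp.limit_zero (h : PicardHyp c K₀ R a) (hT : T = picardTime ι c K₀ R)
    (ξ : EuclideanSpace ℝ ι) : picardLimit c T a 0 ξ = a ξ := by
  rw [h.fixed hT, duhamel_zero (hT ▸ h.time_pos).le]

/-- **All polynomial weights propagate**: if `a` also decays to order `K` with constant `A`,
then `‖v(t, ξ)‖ ≤ 2A e^{λ_K clamp(t)} (1+‖ξ‖)^{-K}` for all `t` (induction along the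
iterates with `hasDecay_duhamel_high`, then passage to the limit). [folklore] -/
theorem PicardHyp.decay_limit_high (h : PicardHyp c K₀ R a) (hT : T = picardTime ι c K₀ R) {K : ℕ}
    {A : ℝ} (haK : HasDecay K A a) (t : ℝ) :
    HasDecay K (2 * A * Real.exp (highRate ι c K K₀ R * clamp T t)) (picardLimit c T a t) := by
  have hTpos : 0 < T := hT ▸ h.time_pos
  have hA := haK.nonneg
  have hiter : ∀ n s, HasDecay K (2 * A * Real.exp (highRate ι c K K₀ R * clamp T s))
      (picardIter c T a n s) := by
    intro n
    induction n with
    | zero =>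
      intro s η
      have hτ := clamp_mem_Icc hTpos.le s
      change ‖heat c η (clamp T s) • a η‖ ≤ _
      rw [norm_heat_smul]
      have he : 1 ≤ Real.exp (highRate ι c K K₀ R * clamp T s) :=
        Real.one_le_exp (mul_nonneg (highRate_pos h.hc K K₀ R).le hτ.1)
      calc heat c η (clamp T s) * ‖a η‖ ≤ 1 * (A * ((1 + ‖η‖) ^ K)⁻¹) :=
            mul_le_mul (heat_le_one h.hc.le hτ.1 η) (haK η) (norm_nonneg _) zero_le_one
        _ = 1 * A * 1 * ((1 + ‖η‖) ^ K)⁻¹ := by ring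
        _ ≤ 2 * A * Real.exp (highRate ι c K K₀ R * clamp T s) * ((1 + ‖η‖) ^ K)⁻¹ := by
            gcongr; norm_num
    | succ n ih =>
      intro s
      exact hasDecay_duhamel_high h.hc h.hK₀ hTpos h.R_nonneg haK (h.continuous_iter hT n)
        (h.decay_iter hT n) ih s
  intro ξ
  exact h.norm_limit_le_of_iter hT fun n => hiter n t ξ

/-- Uniform-in-time form of the propagated decay: `‖v(t,ξ)‖ ≤ 2A e^{λ_K T}(1+‖ξ‖)^{-K}`. [folklore] -/
theorem PicardHyp.decay_limit_high' (h : PicardHyp c K₀ R a) (hT : T = picardTime ι c K₀ R) {K : ℕ}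
    {A : ℝ} (haK : HasDecay K A a) (t : ℝ) :
    HasDecay K (2 * A * Real.exp (highRate ι c K K₀ R * T)) (picardLimit c T a t) := by
  have hTpos : 0 < T := hT ▸ h.time_pos
  refine (h.decay_limit_high hT haK t).mono ?_
  have hA := haK.nonneg
  gcongr
  · exact (highRate_pos h.hc K K₀ R).le
  · exact (clamp_mem_Icc hTpos.le t).2

/-- **The limit is divergence free on the Fourier side** when the datum is. [folklore] -/
theorem PicardHyp.sum_mul_limit (h : PicardHyp c K₀ R a) (hT : T = picardTime ι c K₀ R)
    (hdiv : ∀ ξ, ∑ l, (ξ l : ℂ) * a ξ l = 0) (t : ℝ) (ξ : EuclideanSpace ℝ ι) :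
    ∑ l, (ξ l : ℂ) * picardLimit c T a t ξ l = 0 := by
  have hfix : picardLimit c T a t ξ = duhamel c T a (picardLimit c T a) t ξ := h.fixed hT t ξ
  rw [hfix]
  exact sum_mul_duhamel h.hK₀ (h.continuous_limit hT) (h.decay_limit hT) hdiv t ξ

/-- **Conjugation symmetry of the limit** when the datum has it (induction along the iterates,
closedness in the limit). [folklore] -/
theorem PicardHyp.limit_conj_symm (h : PicardHyp c K₀ R a) (hT : T = picardTime ι c K₀ R)
    (ha : ∀ ξ l, a (-ξ) l = conj (a ξ l)) (t : ℝ) (ξ : EuclideanSpace ℝ ι) (l : ι) :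
    picardLimit c T a t (-ξ) l = conj (picardLimit c T a t ξ l) := by
  have hiter : ∀ n s ζ j, picardIter c T a n s (-ζ) j = conj (picardIter c T a n s ζ j) := by
    intro n
    induction n with
    | zero =>
      intro s ζ j
      simp [picardIter, Complex.real_smul, ha]
    | succ n ih =>
      intro s ζ j
      exact duhamel_conj_symm h.hK₀ (h.continuous_iter hT n) (h.decay_iter hT n) ha ih s ζ j
  have h1 : Tendsto (fun n => picardIter c T a n t (-ξ) l) atTop (𝓝 (picardLimit c T a t (-ξ) l)) :=
    ((continuous_apply l).tendsto _).comp (h.tendsto_iter hT t (-ξ))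
  have h2 : Tendsto (fun n => conj (picardIter c T a n t ξ l)) atTop
      (𝓝 (conj (picardLimit c T a t ξ l))) :=
    (Complex.continuous_conj.tendsto _).comp (((continuous_apply l).tendsto _).comp
      (h.tendsto_iter hT t ξ))
  simp_rw [hiter] at h1
  exact tendsto_nhds_unique h1 h2

end Iteration

end Literature.Analysis.FluidPDE.FourierNS

end
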